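import Mathlib
import HarnessLib

/-!
# Markman 2025 — «`dim Ext²(E, E)` grows quadratically with `q`, while the co-domain of `σ_E` is independent of `q`»
# ([S] §11.4, after Question 11.4): the dimension count AS PRINTED, kernel-checked

E. Markman: [S] *Secant sheaves and Weil classes on abelian varieties*, arXiv:2509.23403 **v2** (2026-02-11), bib
`Markman2025SurveySecant` (survey; the results it reports are PREPRINT); [M] *Cycles on abelian 2n-folds of Weil type
from secant sheaves on abelian n-folds*, arXiv:2502.03415 **v2** (2025-06-08), bib `Markman2025SecantWeil` — UNREFEREED
PREPRINT. Pages/lines = PyMuPDF lines of the public arXiv PDFs (v2 of [S]: sha256/16 `3151aee3307548da`; v2 of [M]: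
`8155aa33870069b8`), read at seat lit-w-markman (pub-hsemireg, 2026-08-23).

## What is printed (verbatim)
* [S] v2 p. 20 L32–37: «The sheaf `E` of Proposition 11.1(4) cannot be semi-regular for all `q ≥ 4`, since
  `dim Ext²(E, E)` grows quadratically with `q`, by [M2, Lem. 8.3.8], while the co-domain of `σ_E` is independent of
  `q`. Fortunately, `σ_E` restricts as an injective map to `Ext²(E, E)^{Ḡ}`, which contains the image of `ev_E`.
  Descending to the quotient abelian variety `A := (X × X̂)/Ḡ` enables us to use the semi-regularity theorem and
  avoid Question 11.4.»  (`q` even and `≥ 4`: p. 18 L5–7 «We may also choose `q` to be even and `≥ 4`, since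
  `ℚ(√−q) = ℚ(√−4q)`.»)
* [S] v2 p. 6 L17–20: «The semi-regularity map is `σ_E := (σ_0, …, σ_{N−2}) : Ext²(E, E) → ⊕_{q=0}^{N−2} H^{q,q+2}(Y)`.
  The sheaf `E` is semi-regular, if `σ_E` is injective.» (`N = dim Y`; here `Y = X × X̂`, `N = 6`); [M] v2 p. 82
  L31–40: «The semi-regularity map `σ : Hom(G, G[2]) → ⊕_{q=0}^{4} H^{q+2}(Ω^q_{X×X̂})` restricts to an injective
  homomorphism from `Hom(G, G[2])^G`, …».
* [S] v2 §11.1 p. 18 L10–14: «Let `C_i ⊂ X`, `1 ≤ i ≤ q + 1`, be `q + 1` disjoint translates of `AJ(C)` … Set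
  `F₁ := I_{∪_{i=1}^{q+1} C_i}(Θ)`»; PROP. 11.1 p. 18 L44–53: «… the object `G := Φ(F₂ ⊠ F₁)[−3]` over `X × X̂` …
  (4) The object `G^∨[−1]` is represented by a coherent sheaf `E` …».
* [M] v2 LEMMA 8.3.2 (p. 57 L21–22; `F := I_{∪_{i=1}^n C_i}`, `n` disjoint translates): «The homomorphism (8.3.1) is an
  isomorphism. Consequently, `dim Ext¹(F, F) = 3n + 3`.»; p. 60 L21–50: «… each `Ẽ¹_i` is 3-dimensional. … The Yoneda
  product `Ext¹(F, F) ⊗ Ext²(F, F) → Ext³(F, F)` is a perfect pairing. … Then `E²_i` is 3-dimensional, for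
  `0 ≤ i ≤ n`. … We get the direct sum decomposition `Ext²(F, F) = ⊕_{i=0}^n E²_i`.» (the decomposition behind
  [S]'s pointer «[M2, Lem. 8.3.8]»); p. 59 L81–82 (proof of Lemma 8.3.7 (1)): «This is the case `n = 1`. In this case
  `Ext²(I_{C_j}, I_{C_j})` is 6-dimensional, by Lemma 8.3.2»; §8.4 p. 63 L70–75: «The Künneth decomposition of
  `Ext²(π₁^*F₁ ⊗ π₂^*F₂, π₁^*F₁ ⊗ π₂^*F₂)` is the direct sum
  `[Ext²(F₁, F₁) ⊗ Ext⁰(F₂, F₂)] ⊕ [Ext⁰(F₁, F₁) ⊗ Ext²(F₂, F₂)] ⊕ [Ext¹(F₁, F₁) ⊗ Ext¹(F₂, F₂)]`.»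

## What this file proves (arithmetic of those sentences; theorems only; NO named fact; nothing geometric)
With the printed values `dim Ext¹(F_i, F_i) = dim Ext²(F_i, F_i) = 3(q+1) + 3 = 3q + 6` (Lemma 8.3.2 and p. 60 for
`n = q + 1` translates), `dim Hom(F_i, F_i) = 1`, and the Künneth decomposition of §8.4, the count
`dim Ext²(F₂ ⊠ F₁, F₂ ⊠ F₁) = (3q+6)·1 + 1·(3q+6) + (3q+6)² = (3q+6)(3q+8) = 9q² + 42q + 48` — a quadratic in `q`;
the co-domain `⊕_{p=0}^{4} H^{p,p+2}(X × X̂)` has dimension `Σ_p C(6,p)·C(6,p+2) = 495 = C(12,4)` (Hodge numbers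
`h^{p,q} = C(6,p)C(6,q)` of an abelian sixfold), independent of `q`; `(3q+6)(3q+8) ≤ 495 ⟺ q ≤ 5`; so the dimension
count EXCLUDES injectivity of `σ_E` on all of `Ext²(E, E)` exactly for `q ≥ 6` (`624 > 495` at `q = 6`) and is SILENT
at the first admissible value `q = 4` (`360 ≤ 495`): the printed «cannot be semi-regular for all `q ≥ 4`» is the
«not for every `q ≥ 4`» reading, which is all that «grows quadratically» supports; plus the linear-algebra face
(`finrank V > finrank W ⟹` no injective linear map `V → W`).

## Inputs BY VALUE (NOT proved here) and honest framing
`Ext²(E, E) ≅ Ext²(F₂ ⊠ F₁, F₂ ⊠ F₁)` (Orlov's `Φ` is an equivalence, `E ≅ G^∨[−1]`, dualization and shift preserve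
self-Ext), the Künneth formula, `Hom(F_i, F_i) = ℂ`, the Hodge numbers of an abelian variety, and all of [M] §8.3 are
inputs; the kernel adds only the arithmetic. This is the ×1-kernel leg of the LIT-W print-reading note (sheet
LOCATOR-SHEET-MARKMAN.md §30 (30.6)); what [S]/[M] PROVE is injectivity of `σ_E` on `Ext²(E, E)^{Ḡ} ⊇ im(ev_E)` and
the semiregularity of the DESCENDED sheaf `Ē` ([S] Prop. 11.5, [M] Lemma 9.3.11) — untouched here. Nothing in this
file says that `E` is or is not semiregular at `q = 4`, and nothing here bears on HC / HC_CM / HC_AV.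
-/

namespace Literature.AlgebraicGeometry.Markman2025

/-- **[M] v2 p. 60 L21–50 with LEMMA 8.3.2 (p. 57 L21–22)**: `Ext²(F, F) = ⊕_{i=0}^{n} E²_i` with each `E²_i`
3-dimensional, so `dim Ext²(F, F) = 3(n + 1) = 3n + 3 = dim Ext¹(F, F)`; the case `n = 1` is the printed
«`Ext²(I_{C_j}, I_{C_j})` is 6-dimensional» (p. 59 L81–82); for [S]'s `F_i` (`n = q + 1` translates) the value is
`3q + 6`. [cite: Markman2025SecantWeil, Lemma 8.3.2 and §8.3 v2 p. 60 L21–50, p. 59 L81–82] -/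
theorem extTwo_translates (n q : ℕ) :
    (∑ _i ∈ Finset.range (n + 1), 3) = 3 * n + 3 ∧ 3 * 1 + 3 = 6 ∧ 3 * (q + 1) + 3 = 3 * q + 6 := by
  refine ⟨?_, by norm_num, by ring⟩
  simp [Finset.sum_const, Finset.card_range]; ring

/-- **[M] §8.4, v2 p. 63 L70–75 (Künneth decomposition of `Ext²` of a box product) with the printed dimensions**:
for [S]'s `F₁, F₂` (`dim Hom = 1`, `dim Ext¹ = dim Ext² = 3q + 6`),
`dim Ext²(F₂ ⊠ F₁, F₂ ⊠ F₁) = (3q+6)·1 + 1·(3q+6) + (3q+6)·(3q+6) = (3q+6)(3q+8) = 9q² + 42q + 48` — «grows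
quadratically with `q`» ([S] p. 20 L33); at `q = 0` (one translate on each side) the count is `48`.
[cite: Markman2025SecantWeil, §8.4, v2 p. 63 L70–75] [cite: Markman2025SurveySecant, §11.4, v2 p. 20 L32–34] -/
theorem extTwo_boxProduct (q : ℕ) :
    (3 * q + 6) * 1 + 1 * (3 * q + 6) + (3 * q + 6) * (3 * q + 6) = (3 * q + 6) * (3 * q + 8) ∧
    (3 * q + 6) * (3 * q + 8) = 9 * q ^ 2 + 42 * q + 48 ∧ (3 * 0 + 6) * (3 * 0 + 8) = 48 := by
  refine ⟨by ring, by ring, by norm_num⟩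

/-- **[S] v2 p. 6 L17–20 / [M] v2 p. 82 L31–38, the co-domain `⊕_{p=0}^{4} H^{p,p+2}(X × X̂)` of `σ_E`** on the
abelian sixfold `X × X̂` (`N = 6`): with the Hodge numbers `h^{p,q} = C(6,p)·C(6,q)` of an abelian sixfold
(standard, by value) its dimension is `Σ_{p=0}^{4} C(6,p)C(6,p+2) = 15 + 120 + 225 + 120 + 15 = 495 = C(12,4)` —
«independent of `q`» ([S] p. 20 L33–34).
[cite: Markman2025SurveySecant, §2, v2 p. 6 L17–20] [cite: Markman2025SecantWeil, §9.3, v2 p. 82 L31–38] -/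
theorem sigmaCodomain_dim_sixfold :
    (∑ p ∈ Finset.range 5, Nat.choose 6 p * Nat.choose 6 (p + 2)) = 495 ∧
    (Nat.choose 6 0 * Nat.choose 6 2 = 15 ∧ Nat.choose 6 1 * Nat.choose 6 3 = 120 ∧
      Nat.choose 6 2 * Nat.choose 6 4 = 225 ∧ Nat.choose 6 3 * Nat.choose 6 5 = 120 ∧
      Nat.choose 6 4 * Nat.choose 6 6 = 15) ∧
    Nat.choose 12 4 = 495 := by
  refine ⟨by decide, by decide, by decide⟩

/-- **The count behind [S] v2 p. 20 L32–34** «cannot be semi-regular for all `q ≥ 4`, since `dim Ext²(E, E)` grows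
quadratically with `q` … while the co-domain of `σ_E` is independent of `q`»: `(3q+6)(3q+8) ≤ 495 ⟺ q ≤ 5`;
the values `360` (`q = 4`), `483` (`q = 5`), `624` (`q = 6`), `960` (`q = 8`). Hence the dimension count rules out
injectivity of `σ_E` on all of `Ext²(E, E)` exactly for `q ≥ 6` and is silent at `q = 4` (the first value allowed by
p. 18 L5–7): the printed sentence is the «not for EVERY `q ≥ 4`» statement (seat's reading; print asserts no more).
[cite: Markman2025SurveySecant, §11.4, v2 p. 20 L32–34] -/
theorem extTwo_le_codomain_iff (q : ℕ) :
    ((3 * q + 6) * (3 * q + 8) ≤ 495 ↔ q ≤ 5) ∧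
    ((3 * 4 + 6) * (3 * 4 + 8) = 360 ∧ (3 * 5 + 6) * (3 * 5 + 8) = 483 ∧ (3 * 6 + 6) * (3 * 6 + 8) = 624 ∧
      (3 * 8 + 6) * (3 * 8 + 8) = 960) ∧
    (¬ (∀ q' : ℕ, 4 ≤ q' → (3 * q' + 6) * (3 * q' + 8) ≤ 495)) ∧ (3 * 4 + 6) * (3 * 4 + 8) ≤ 495 ∧
    (∀ q' : ℕ, 6 ≤ q' → 495 < (3 * q' + 6) * (3 * q' + 8)) := by
  refine ⟨⟨fun h => ?_, fun h => ?_⟩, by norm_num, fun h => ?_, by norm_num, fun q' hq' => by nlinarith⟩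
  · by_contra h'
    push Not at h'
    nlinarith
  · interval_cases q <;> norm_num
  · have := h 6 (by norm_num)
    norm_num at this

/-- The linear-algebra face of «cannot be semi-regular»: a linear map out of a space of larger dimension than its
(finite-dimensional) co-domain is not injective — so `σ_E : Ext²(E, E) → ⊕_p H^{p,p+2}` cannot be injective once
`dim Ext²(E, E) > 495`. [cite: Markman2025SurveySecant, §2, v2 p. 6 L17–20 («semi-regular, if `σ_E` is injective»)] -/
theorem not_injective_of_finrank_lt {K V W : Type*} [Field K] [AddCommGroup V] [Module K V] [AddCommGroup W]
    [Module K W] [FiniteDimensional K W] (f : V →ₗ[K] W) (h : Module.finrank K W < Module.finrank K V) :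
    ¬ Function.Injective f :=
  fun hf => absurd (LinearMap.finrank_le_finrank_of_injective hf) (not_le.mpr h)

end Literature.AlgebraicGeometry.Markman2025
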